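import Mathlib
import HarnessLib
import Summits.Ventures.LatticeQCDFlow.Exactness.NCMCGeneralSpaceBarRestartChainsCLT
import Summits.Ventures.LatticeQCDFlow.Exactness.NCMCGeneralSpaceReplicaTStatisticIndep

/-!
# The BAR lane over `R` independent forward/reverse stream PAIRS of correlated launches: the replica-`t` / jackknife bar on the Bennett root has limiting coverage `L_R(q)` from EVERY family of start pairs

HONEST FRAMING: exact (Metropolis-corrected) sampling algorithms for lattice gauge theory;
figures of merit are autocorrelation/cost numbers at stated couplings and volumes; no
continuum-physics claim.

Venture `LatticeQCDFlow` (cell pub-lqcd), topic `Exactness`; FANOUT row 13 (`eng-snf`, GEN-24).  NEW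
WORK of the cell — the composition of GEN-22
`CrooksPair.tendstoInDistribution_sqrt_mul_barRoot_sub_restartChains` (the BAR lane's CLT
`√n (d̂_n − ΔF) ⇒ N(0, σ²_pair/G²)` along the forward/reverse pair of restart chains from EVERY initial
law of the first record pair) with GEN-23 I `tendsto_measure_abs_studentised_le_of_indep`.  Companion
of `NCMCGeneralSpaceReplicaJarzynskiJackknife` (Jarzynski lane) and
`NCMCGeneralSpaceReplicaReweightedJackknife` (reweighting lane).  No definition; nothing cited as a
fact.

WHY (row 13).  `latflow-snf`'s `estimators.bar` solves the sample Bennett equation on a forward and a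
reverse stream of correlated launches; a batch of `R` independent stream PAIRS gives `R` roots
`d̂_{r,n}` and the engine prints their mean with the between-pair (jackknife) standard error.  For
EVERY family of initial laws of the first record pairs that bar, read with a quantile `q`, has the
universal limiting coverage `L_R(q)` of GEN-23/24 (Student's ratio probability; `(2/π)·arctan q` at
`R = 2`; never above the normal coverage) as soon as `σ²_pair > 0`.

## Content
* **`CrooksPair.tendsto_measure_abs_barReplicaT_le_restartChains`** — Crooks pair, `Z₀, Z₁ ≠ 0`,
  `e^{−ΔF} = Z₁/Z₀`, `K₀`/`K₁` Markov leaving `ν₀`/`ν₁` invariant and dominating non-zero finite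
  `m₀`/`m₁`, `d̂_n` any measurable root selection of the sample Bennett equation, `σ²_pair > 0`
  (GEN-22's Green–Kubo form), `R ≥ 2` independent pairs with ANY initial laws `μ_r` on `E × E`,
  `q ≥ 0`: `P(|(d̄̂_n − ΔF)/ŝe_n| ≤ q) → L_R(q)`; **`…_everyStart`** — pair `r` launched from ANY
  configurations `(x_r, y_r)`.

NOT CLAIMED: the checkable form of `σ²_pair > 0` (GEN-23 V2 `CrooksPair.barPairVariance_pos_of_
variance_pos`); unequal forward/reverse lengths; anything numerical.
-/

namespace Summit.Ventures.LatticeQCDFlow.Exactness.GeneralNCMC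

open MeasureTheory ProbabilityTheory Set Filter Finset
open scoped ENNReal NNReal Topology

variable {Ω E : Type*} [MeasurableSpace Ω] [MeasurableSpace E]

namespace CrooksPair

variable {ν₀ ν₁ : Measure Ω} [IsFiniteMeasure ν₀] [IsFiniteMeasure ν₁] {κF κR : Kernel Ω E}
  [IsMarkovKernel κF] [IsMarkovKernel κR] {s e : E → Ω} {W : E → ℝ}
  {ι : Type*} [Fintype ι] [Nontrivial ι]

/-- **THE BAR LANE'S REPLICA-`t` BAR OVER `R ≥ 2` INDEPENDENT STREAM PAIRS HAS LIMITING COVERAGE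
`L_R(q)`, FROM EVERY FAMILY OF INITIAL LAWS OF THE FIRST RECORD PAIRS.** -/
theorem tendsto_measure_abs_barReplicaT_le_restartChains (K₀ K₁ : Kernel Ω Ω)
    [IsMarkovKernel K₀] [IsMarkovKernel K₁] (h0 : ν₀ univ ≠ 0) (h1 : ν₁ univ ≠ 0)
    (hK₀ : Kernel.Invariant K₀ ν₀) (hK₁ : Kernel.Invariant K₁ ν₁) (h : CrooksPair ν₀ ν₁ κF κR s e W)
    {ΔF : ℝ} (hΔF : Real.exp (-ΔF) = ((ν₀ univ)⁻¹ * ν₁ univ).toReal)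
    {m₀ m₁ : Measure Ω} [IsFiniteMeasure m₀] [IsFiniteMeasure m₁] (hm₀ : m₀ univ ≠ 0)
    (hm₁ : m₁ univ ≠ 0) (hmin₀ : ∀ z, m₀ ≤ K₀ z) (hmin₁ : ∀ z, m₁ ≤ K₁ z)
    {dhat : ℕ → (ℕ → E × E) → ℝ} (hdm : ∀ n, Measurable (dhat n))
    (hdhat : ∀ n, 1 ≤ n → ∀ ω, (∑ i ∈ range n, Real.sigmoid (dhat n ω - W (ω i).1)) -
      ∑ i ∈ range n, Real.sigmoid (W (ω i).2 - dhat n ω) = 0)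
    (hσ : 0 < (∫ p, (Real.sigmoid (ΔF - W p.1) - Real.sigmoid (W p.2 - ΔF)) ^ 2
          ∂((fwdPathLaw ν₀ κF).prod (fwdPathLaw ν₁ κR)))
        + 2 * ∑' k, ∫ p, (Real.sigmoid (ΔF - W p.1) - Real.sigmoid (W p.2 - ΔF))
          * (Scoring.kop (((κF ∘ₖ K₀).comap s h.measurable_s) ∥ₖ
              ((κR ∘ₖ K₁).comap e h.measurable_e)))^[k + 1]
            (fun p => Real.sigmoid (ΔF - W p.1) - Real.sigmoid (W p.2 - ΔF)) p
          ∂((fwdPathLaw ν₀ κF).prod (fwdPathLaw ν₁ κR)))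
    (μ : ι → Measure (E × E)) [∀ r, IsProbabilityMeasure (μ r)]
    [∀ r, IsProbabilityMeasure (Kernel.trajMeasure (X := fun _ : ℕ => E × E) (μ r)
        (fun n : ℕ => (((κF ∘ₖ K₀).comap s h.measurable_s) ∥ₖ ((κR ∘ₖ K₁).comap e h.measurable_e)).comap
          (fun hh : (j : ↥(Finset.Iic n)) → E × E => hh ⟨n, Finset.mem_Iic.2 le_rfl⟩)
          (measurable_pi_apply _)))] {q : ℝ} (hq : 0 ≤ q) :
    Tendsto (fun n : ℕ => (Measure.pi fun r => Kernel.trajMeasure (X := fun _ : ℕ => E × E) (μ r)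
        (fun n : ℕ => (((κF ∘ₖ K₀).comap s h.measurable_s) ∥ₖ ((κR ∘ₖ K₁).comap e h.measurable_e)).comap
          (fun hh : (j : ↥(Finset.Iic n)) → E × E => hh ⟨n, Finset.mem_Iic.2 le_rfl⟩)
          (measurable_pi_apply _)))
        {ω : ι → ℕ → E × E |
          |((∑ r, dhat n (ω r)) / Fintype.card ι - ΔF)
            / Real.sqrt ((∑ r, (dhat n (ω r) - (∑ r', dhat n (ω r')) / Fintype.card ι) ^ 2)
              / ((Fintype.card ι : ℝ) * (Fintype.card ι - 1)))| ≤ q})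
      atTop
      (𝓝 ((Measure.pi fun _ : ι => gaussianReal 0 1) {z : ι → ℝ | |(∑ r, z r) / Fintype.card ι
        / Real.sqrt ((∑ r, (z r - (∑ r', z r') / Fintype.card ι) ^ 2)
            / ((Fintype.card ι : ℝ) * (Fintype.card ι - 1)))| ≤ q})) := by
  -- the overlap `G = E_F σ(ΔF − W)` is positive (GEN-15)
  have hG : 0 < ∫ ε, Real.sigmoid (ΔF - W ε) ∂(fwdPathLaw ν₀ κF) := h.overlap_pos h0 ΔF
  set σ2 : ℝ := (∫ p, (Real.sigmoid (ΔF - W p.1) - Real.sigmoid (W p.2 - ΔF)) ^ 2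
          ∂((fwdPathLaw ν₀ κF).prod (fwdPathLaw ν₁ κR)))
        + 2 * ∑' k, ∫ p, (Real.sigmoid (ΔF - W p.1) - Real.sigmoid (W p.2 - ΔF))
          * (Scoring.kop (((κF ∘ₖ K₀).comap s h.measurable_s) ∥ₖ
              ((κR ∘ₖ K₁).comap e h.measurable_e)))^[k + 1]
            (fun p => Real.sigmoid (ΔF - W p.1) - Real.sigmoid (W p.2 - ΔF)) p
          ∂((fwdPathLaw ν₀ κF).prod (fwdPathLaw ν₁ κR)) with hσ2
  have hv : (σ2 / (∫ ε, Real.sigmoid (ΔF - W ε) ∂(fwdPathLaw ν₀ κF)) ^ 2).toNNReal ≠ 0 := by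
    rw [Ne, Real.toNNReal_eq_zero, not_le]
    exact div_pos hσ (pow_pos hG 2)
  have hclt : ∀ r : ι, TendstoInDistribution (fun (n : ℕ) (ω : ℕ → E × E) =>
        Real.sqrt (n : ℝ) * (dhat n ω - ΔF))
      atTop id (fun _ => Kernel.trajMeasure (X := fun _ : ℕ => E × E) (μ r)
        (fun n : ℕ => (((κF ∘ₖ K₀).comap s h.measurable_s) ∥ₖ
            ((κR ∘ₖ K₁).comap e h.measurable_e)).comap
          (fun hh : (j : ↥(Finset.Iic n)) → E × E => hh ⟨n, Finset.mem_Iic.2 le_rfl⟩)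
          (measurable_pi_apply _)))
      (gaussianReal 0 (σ2 / (∫ ε, Real.sigmoid (ΔF - W ε) ∂(fwdPathLaw ν₀ κF)) ^ 2).toNNReal) :=
    fun r => h.tendstoInDistribution_sqrt_mul_barRoot_sub_restartChains K₀ K₁ h0 h1 hK₀ hK₁ hΔF hm₀
      hm₁ hmin₀ hmin₁ hdm hdhat (μ r) (Ω' := ℝ)
      (P' := gaussianReal 0 (σ2 / (∫ ε, Real.sigmoid (ΔF - W ε) ∂(fwdPathLaw ν₀ κF)) ^ 2).toNNReal)
      (Y := id) HasLaw.id
  exact tendsto_measure_abs_studentised_le_of_indep (Ω := fun _ : ι => ℕ → E × E)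
    (θhat := fun (_ : ι) (n : ℕ) (ω : ℕ → E × E) => dhat n ω) (fun _ n => hdm n) ΔF hv hclt hq

/-- **The engine's form**: pair `r` launched from ANY configurations `x_r` (forward) and `y_r`
(reverse): `μ_r = κF(x_r, ·) ⊗ κR(y_r, ·)`. -/
theorem tendsto_measure_abs_barReplicaT_le_restartChains_everyStart (K₀ K₁ : Kernel Ω Ω)
    [IsMarkovKernel K₀] [IsMarkovKernel K₁] (h0 : ν₀ univ ≠ 0) (h1 : ν₁ univ ≠ 0)
    (hK₀ : Kernel.Invariant K₀ ν₀) (hK₁ : Kernel.Invariant K₁ ν₁) (h : CrooksPair ν₀ ν₁ κF κR s e W)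
    {ΔF : ℝ} (hΔF : Real.exp (-ΔF) = ((ν₀ univ)⁻¹ * ν₁ univ).toReal)
    {m₀ m₁ : Measure Ω} [IsFiniteMeasure m₀] [IsFiniteMeasure m₁] (hm₀ : m₀ univ ≠ 0)
    (hm₁ : m₁ univ ≠ 0) (hmin₀ : ∀ z, m₀ ≤ K₀ z) (hmin₁ : ∀ z, m₁ ≤ K₁ z)
    {dhat : ℕ → (ℕ → E × E) → ℝ} (hdm : ∀ n, Measurable (dhat n))
    (hdhat : ∀ n, 1 ≤ n → ∀ ω, (∑ i ∈ range n, Real.sigmoid (dhat n ω - W (ω i).1)) -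
      ∑ i ∈ range n, Real.sigmoid (W (ω i).2 - dhat n ω) = 0)
    (hσ : 0 < (∫ p, (Real.sigmoid (ΔF - W p.1) - Real.sigmoid (W p.2 - ΔF)) ^ 2
          ∂((fwdPathLaw ν₀ κF).prod (fwdPathLaw ν₁ κR)))
        + 2 * ∑' k, ∫ p, (Real.sigmoid (ΔF - W p.1) - Real.sigmoid (W p.2 - ΔF))
          * (Scoring.kop (((κF ∘ₖ K₀).comap s h.measurable_s) ∥ₖ
              ((κR ∘ₖ K₁).comap e h.measurable_e)))^[k + 1]
            (fun p => Real.sigmoid (ΔF - W p.1) - Real.sigmoid (W p.2 - ΔF)) p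
          ∂((fwdPathLaw ν₀ κF).prod (fwdPathLaw ν₁ κR)))
    (x y : ι → Ω)
    [∀ r, IsProbabilityMeasure (Kernel.trajMeasure (X := fun _ : ℕ => E × E)
        ((κF (x r)).prod (κR (y r)))
        (fun n : ℕ => (((κF ∘ₖ K₀).comap s h.measurable_s) ∥ₖ ((κR ∘ₖ K₁).comap e h.measurable_e)).comap
          (fun hh : (j : ↥(Finset.Iic n)) → E × E => hh ⟨n, Finset.mem_Iic.2 le_rfl⟩)
          (measurable_pi_apply _)))] {q : ℝ} (hq : 0 ≤ q) :
    Tendsto (fun n : ℕ => (Measure.pi fun r => Kernel.trajMeasure (X := fun _ : ℕ => E × E)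
        ((κF (x r)).prod (κR (y r)))
        (fun n : ℕ => (((κF ∘ₖ K₀).comap s h.measurable_s) ∥ₖ ((κR ∘ₖ K₁).comap e h.measurable_e)).comap
          (fun hh : (j : ↥(Finset.Iic n)) → E × E => hh ⟨n, Finset.mem_Iic.2 le_rfl⟩)
          (measurable_pi_apply _)))
        {ω : ι → ℕ → E × E |
          |((∑ r, dhat n (ω r)) / Fintype.card ι - ΔF)
            / Real.sqrt ((∑ r, (dhat n (ω r) - (∑ r', dhat n (ω r')) / Fintype.card ι) ^ 2)
              / ((Fintype.card ι : ℝ) * (Fintype.card ι - 1)))| ≤ q})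
      atTop
      (𝓝 ((Measure.pi fun _ : ι => gaussianReal 0 1) {z : ι → ℝ | |(∑ r, z r) / Fintype.card ι
        / Real.sqrt ((∑ r, (z r - (∑ r', z r') / Fintype.card ι) ^ 2)
            / ((Fintype.card ι : ℝ) * (Fintype.card ι - 1)))| ≤ q})) :=
  h.tendsto_measure_abs_barReplicaT_le_restartChains K₀ K₁ h0 h1 hK₀ hK₁ hΔF hm₀ hm₁ hmin₀ hmin₁ hdm
    hdhat hσ (fun r => (κF (x r)).prod (κR (y r))) hq

end CrooksPair

end Summit.Ventures.LatticeQCDFlow.Exactness.GeneralNCMC
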